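import Summits.KontsevichZagierPeriods.Zeta5Search.Barrier.ConeGammaTorus

/-!
# ζ(5) search — BARRIER: integrability of `N_a u⁻²` and the EXACT PERIOD FORMULA for `Φ` at rational directions

HONEST FRAMING (cell `pub-zeta5`): systematic search; no irrationality claim unless kernel-certified. MODEL objects
under Brown–Zudilin's (28)+(30) accounting ([BZ22] = arXiv:2210.03391); nothing here is a statement about `ζ(5)`;
records in print UNMOVED. Infrastructure for the cell's `BARRIER-PLAN.md` §2b, item (P3) of the «provable now»
list (theory seat cert-2 g17, WAKE w3 of lead/lit g23). What it buys: the tree's `phi30 a = ∫_{(0,∞)} N_a(u) u⁻² du`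
(a Bochner integral, so far only a DEFINITION whose value entered the record pins as a hypothesis `hΦ`) is, for
every direction of the closed box, the integral of an honestly INTEGRABLE function (`integrableOn_savingN_div_sq`:
`N_a` is measurable, vanishes on `(0, 1/(2s₀))` and is bounded by `7`), and at a RATIONAL direction (period `T`:
`T·h_k(a) ∈ ℤ` for all 28 forms) it is an exact, finite expression in the breakpoint data of ONE period:

* `hasSum_integral_periods` — `Φ(a) = Σ_{k≥0} ∫_{(kT,(k+1)T]} N_a u⁻²` (countable additivity over the periods);
* `integral_gap`, `integral_period_eq_sum` — on a gap `(kT+b_m, kT+b_{m+1})` of the breakpoint partition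
  `0 = b₀ ≤ b₁ ≤ ⋯ ≤ b_M = T` the saving is the constant `c_m` (periodicity `savingN_add_nat_mul_period`), so the
  `k`-th period contributes `Σ_m c_m (1/(kT+b_m) − 1/(kT+b_{m+1}))` (the first gap has `c₀ = 0`,
  `gapValue_zero_eq`, which also covers Lean's `1/0 = 0` at `k = m = 0`);
* **`hasSum_phi30_breakpoints`**, **`phi30_eq_sum_tsum`** — `Φ(a) = Σ_{m<M} c_m · Σ_{k≥0} (1/(kT+b_m) − 1/(kT+b_{m+1}))`
  (each inner series summable, `summable_gapSeries`);
* the identification of the inner series with digamma differences, `(ψ(b_{m+1}/T) − ψ(b_m/T))/T`, is the sequel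
  file `ConeGammaPeriodDigamma` (it needs the tree's Gauss/AAR digamma series).
Not here (honest): the evaluation of the `c_m` at any specific direction (so `hΦ` in the record/flag/ridge pins is
NOT discharged by this file), and the `ψ′`-form `λ⁻²∫₀^λ 𝒩 ψ′(v/λ) dv` (sum–integral interchange not needed for
the finite formula).
-/

noncomputable section

open Set MeasureTheory Filter
open scoped Topology

namespace Summit.KontsevichZagierPeriods.Zeta5Search.Barrier.ConeGamma

/-! ### The forms are at most `2s₀` on the box; `N_a = 0` near `u = 0` -/

/-- On the closed box every form is at most `2s₀` (`s_i + s_j ≤ 2s₀`, `s₀ − s_j ≤ s₀`). -/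
theorem h28_le_two_mul_s0 {a : Dir} (h : BZBox a) (k : Fin 28) : h28 a k ≤ 2 * sParam a 0 := by
  obtain ⟨h0, hj⟩ := h
  obtain ⟨h1a, h1b⟩ := hj 0
  obtain ⟨h2a, h2b⟩ := hj 1
  obtain ⟨h3a, h3b⟩ := hj 2
  obtain ⟨h4a, h4b⟩ := hj 3
  obtain ⟨h5a, h5b⟩ := hj 4
  obtain ⟨h6a, h6b⟩ := hj 5
  obtain ⟨h7a, h7b⟩ := hj 6
  simp only [Fin.succ_zero_eq_one] at h1a h1b
  change 0 ≤ sParam a 2 at h2a; change sParam a 2 ≤ sParam a 0 at h2b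
  change 0 ≤ sParam a 3 at h3a; change sParam a 3 ≤ sParam a 0 at h3b
  change 0 ≤ sParam a 4 at h4a; change sParam a 4 ≤ sParam a 0 at h4b
  change 0 ≤ sParam a 5 at h5a; change sParam a 5 ≤ sParam a 0 at h5b
  change 0 ≤ sParam a 6 at h6a; change sParam a 6 ≤ sParam a 0 at h6b
  change 0 ≤ sParam a 7 at h7a; change sParam a 7 ≤ sParam a 0 at h7b
  have ha : h28 a = h28 (aOfS (sParam a)) := by rw [aOfS_sParam]
  rw [ha, h28_aOfS]
  fin_cases k <;> simp <;> linarith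

/-- `S₇` fixes `s₀`. -/
theorem sParam_permAct_zero (σ : Equiv.Perm (Fin 7)) (a : Dir) : sParam (permAct σ a) 0 = sParam a 0 := by
  simp [permAct, sParam_aOfS, permS]

open scoped Classical in
/-- **`N_a(u) = 0` for `0 ≤ u` with `2s₀·u < 1`**: every floor `⌊h_k(σa)u⌋` in (29) vanishes. -/
theorem savingN_eq_zero_of_small {a : Dir} (ha : BZBox a) {u : ℝ} (hu0 : 0 ≤ u)
    (hu : u * (2 * sParam a 0) < 1) : savingN a u = 0 := by
  have hfloor : ∀ σ : Equiv.Perm (Fin 7), ∀ k, ⌊h28 (permAct σ a) k * u⌋ = 0 := by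
    intro σ k
    rw [Int.floor_eq_zero_iff]
    refine ⟨mul_nonneg (h28_nonneg_of_BZBox (BZBox_permAct ha σ) k) hu0, ?_⟩
    calc h28 (permAct σ a) k * u ≤ 2 * sParam (permAct σ a) 0 * u :=
          mul_le_mul_of_nonneg_right (h28_le_two_mul_s0 (BZBox_permAct ha σ) k) hu0
      _ = u * (2 * sParam a 0) := by rw [sParam_permAct_zero]; ring
      _ < 1 := hu
  have hterm : ∀ σ, savingTerm a u σ = 0 := by
    intro σ
    unfold savingTerm
    split_ifs
    · refine Finset.sum_eq_zero fun k _ => ?_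
      have h1 := hfloor 1 k
      rw [permAct_one] at h1
      rw [h1, hfloor σ k, sub_zero]
    · rfl
  unfold savingN
  apply le_antisymm
  · exact Finset.sup'_le _ _ fun σ _ => (hterm σ).le
  · have := Finset.le_sup' (savingTerm a u) (Finset.mem_univ (1 : Equiv.Perm (Fin 7)))
    rwa [hterm 1] at this

/-- `N_a(u) = 0` on `[0, 1/(2s₀))`. -/
theorem savingN_eq_zero_of_lt {a : Dir} (ha : BZBox a) {u : ℝ} (hu0 : 0 ≤ u) (hu : u < 1 / (2 * sParam a 0)) :
    savingN a u = 0 :=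
  savingN_eq_zero_of_small ha hu0 (by rwa [lt_div_iff₀ (by linarith [ha.1])] at hu)

/-- The value of the saving on a first gap `(0, β)` is `0`. -/
theorem gapValue_zero_eq {a : Dir} (ha : BZBox a) {β : ℝ} (hβ : 0 < β) {c : ℤ}
    (hc : ∀ u ∈ Set.Ioo 0 β, savingN a u = c) : c = 0 := by
  have hε : 0 < 1 / (2 * sParam a 0) := by have := ha.1; positivity
  set u₀ : ℝ := min β (1 / (2 * sParam a 0)) / 2 with hu₀
  have hmin : 0 < min β (1 / (2 * sParam a 0)) := lt_min hβ hε
  have h0 : 0 < u₀ := by positivity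
  have h1 : u₀ < β := by
    have := min_le_left β (1 / (2 * sParam a 0)); rw [hu₀]; linarith
  have h2 : u₀ < 1 / (2 * sParam a 0) := by
    have := min_le_right β (1 / (2 * sParam a 0)); rw [hu₀]; linarith
  rw [← hc u₀ ⟨h0, h1⟩, savingN_eq_zero_of_lt ha h0.le h2]

/-! ### Measurability and integrability of `u ↦ N_a(u) u⁻²` -/

open scoped Classical in
/-- Each `σ`-term of (29) is a measurable function of `u`. -/
theorem measurable_savingTerm (a : Dir) (σ : Equiv.Perm (Fin 7)) :
    Measurable fun u : ℝ => (savingTerm a u σ : ℝ) := by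
  by_cases hσ : Admissible a σ
  · have h : (fun u : ℝ => (savingTerm a u σ : ℝ)) =
        fun u => ∑ i ∈ FIdx, (((⌊h28 a i * u⌋ : ℤ) : ℝ) - ((⌊h28 (permAct σ a) i * u⌋ : ℤ) : ℝ)) := by
      funext u; unfold savingTerm; rw [if_pos hσ]; push_cast; rfl
    rw [h]
    refine Finset.measurable_sum _ fun i _ => ?_
    exact ((measurable_of_countable _).comp ((measurable_const.mul measurable_id).floor)).sub
      ((measurable_of_countable _).comp ((measurable_const.mul measurable_id).floor))
  · have h : (fun u : ℝ => (savingTerm a u σ : ℝ)) = fun _ => 0 := by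
      funext u; unfold savingTerm; rw [if_neg hσ]; simp
    rw [h]; exact measurable_const

/-- `N_a(u)`, cast to `ℝ`, is the `max` of the cast terms. -/
theorem savingN_cast_eq_sup' (a : Dir) (u : ℝ) :
    (savingN a u : ℝ) = (Finset.univ : Finset (Equiv.Perm (Fin 7))).sup' Finset.univ_nonempty
      (fun σ => (savingTerm a u σ : ℝ)) := by
  unfold savingN
  exact Finset.apply_sup'_eq_sup'_comp Finset.univ_nonempty (fun z : ℤ => (z : ℝ)) fun _ _ => Int.cast_max

/-- **`u ↦ N_a(u)` is measurable.** -/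
theorem measurable_savingN (a : Dir) : Measurable fun u : ℝ => (savingN a u : ℝ) := by
  have h : (fun u : ℝ => (savingN a u : ℝ)) = (Finset.univ : Finset (Equiv.Perm (Fin 7))).sup'
      Finset.univ_nonempty (fun σ => fun u : ℝ => (savingTerm a u σ : ℝ)) := by
    funext u; rw [savingN_cast_eq_sup', Finset.sup'_apply]
  rw [h]
  exact Finset.measurable_sup' _ fun σ _ => measurable_savingTerm a σ

/-- **Integrability (P3)**: `u ↦ N_a(u) u⁻²` is integrable on `(0, ∞)` for every `a` in the closed box (it vanishes
on `(0, 1/(2s₀))` and is dominated by `7u⁻²` beyond). -/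
theorem integrableOn_savingN_div_sq {a : Dir} (ha : BZBox a) :
    IntegrableOn (fun u : ℝ => (savingN a u : ℝ) / u ^ 2) (Set.Ioi 0) := by
  set ε : ℝ := 1 / (2 * sParam a 0) with hε
  have hε0 : 0 < ε := by have := ha.1; positivity
  have hsplit : Set.Ioi (0 : ℝ) = Set.Ioo 0 ε ∪ Set.Ici ε := by
    ext u
    simp only [Set.mem_Ioi, Set.mem_union, Set.mem_Ioo, Set.mem_Ici]
    constructor
    · intro hu
      rcases lt_or_ge u ε with h | h
      · exact Or.inl ⟨hu, h⟩
      · exact Or.inr h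
    · rintro (⟨hu, _⟩ | h)
      · exact hu
      · exact hε0.trans_le h
  rw [hsplit]
  refine IntegrableOn.union ?_ ?_
  · refine integrableOn_zero.congr_fun (fun u hu => ?_) measurableSet_Ioo
    simp only [Set.mem_Ioo] at hu
    rw [savingN_eq_zero_of_lt ha hu.1.le hu.2]
    simp
  · have hg : IntegrableOn (fun u : ℝ => 7 * u ^ (-2 : ℝ)) (Set.Ici ε) := by
      rw [integrableOn_Ici_iff_integrableOn_Ioi]
      have h := integrableOn_Ioi_rpow_of_lt (by norm_num : (-2 : ℝ) < -1) hε0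
      exact Integrable.const_mul h 7
    refine Integrable.mono' hg ((measurable_savingN a).div (measurable_id.pow_const 2)).aestronglyMeasurable ?_
    refine ae_restrict_of_forall_mem measurableSet_Ici fun u hu => ?_
    have hu0 : 0 < u := hε0.trans_le hu
    rw [Real.norm_eq_abs, abs_div, abs_of_pos (pow_pos hu0 2), Real.rpow_neg hu0.le, Real.rpow_two,
      ← div_eq_mul_inv]
    exact div_le_div_of_nonneg_right (by
      rw [abs_of_nonneg (by exact_mod_cast savingN_nonneg a u)]
      exact_mod_cast savingN_le_seven_of_BZBox ha u) (pow_pos hu0 2).le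

/-! ### Periodisation -/

/-- The periods tile `(0, ∞)`. -/
theorem iUnion_Ioc_mul {T : ℝ} (hT : 0 < T) : (⋃ k : ℕ, Set.Ioc ((k : ℝ) * T) ((k + 1) * T)) = Set.Ioi 0 := by
  ext u
  simp only [Set.mem_iUnion, Set.mem_Ioc, Set.mem_Ioi]
  constructor
  · rintro ⟨k, hk, _⟩
    exact lt_of_le_of_lt (by positivity) hk
  · intro hu
    have h1 : 1 ≤ ⌈u / T⌉₊ := Nat.one_le_iff_ne_zero.mpr (Nat.ceil_pos.mpr (div_pos hu hT)).ne'
    refine ⟨⌈u / T⌉₊ - 1, ?_, ?_⟩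
    · have h2 : (⌈u / T⌉₊ : ℝ) < u / T + 1 := Nat.ceil_lt_add_one (div_pos hu hT).le
      rw [Nat.cast_sub h1, Nat.cast_one]
      calc ((⌈u / T⌉₊ : ℝ) - 1) * T < u / T * T := mul_lt_mul_of_pos_right (by linarith) hT
        _ = u := div_mul_cancel₀ u hT.ne'
    · rw [Nat.cast_sub h1, Nat.cast_one, sub_add_cancel]
      calc u = u / T * T := (div_mul_cancel₀ u hT.ne').symm
        _ ≤ ⌈u / T⌉₊ * T := mul_le_mul_of_nonneg_right (Nat.le_ceil _) hT.le

/-- The periods are pairwise disjoint. -/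
theorem pairwise_disjoint_Ioc_mul {T : ℝ} (hT : 0 < T) :
    Pairwise (Function.onFun Disjoint fun k : ℕ => Set.Ioc ((k : ℝ) * T) ((k + 1) * T)) := by
  intro i j hij
  rw [Function.onFun, Set.disjoint_left]
  intro u hi hj
  rcases lt_or_gt_of_ne hij with h | h
  · have h' : (i : ℝ) + 1 ≤ j := by exact_mod_cast h
    have := mul_le_mul_of_nonneg_right h' hT.le
    exact absurd (lt_of_le_of_lt (hi.2.trans this) hj.1) (lt_irrefl u)
  · have h' : (j : ℝ) + 1 ≤ i := by exact_mod_cast h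
    have := mul_le_mul_of_nonneg_right h' hT.le
    exact absurd (lt_of_le_of_lt (hj.2.trans this) hi.1) (lt_irrefl u)

/-- **Periodisation (P3)**: `Φ(a) = Σ_{k≥0} ∫_{(kT,(k+1)T]} N_a(u) u⁻² du` for every `T > 0`. -/
theorem hasSum_integral_periods {a : Dir} (ha : BZBox a) {T : ℝ} (hT : 0 < T) :
    HasSum (fun k : ℕ => ∫ u in Set.Ioc ((k : ℝ) * T) ((k + 1) * T), (savingN a u : ℝ) / u ^ 2) (phi30 a) := by
  unfold phi30
  have h := MeasureTheory.hasSum_integral_iUnion (μ := volume)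
    (f := fun u : ℝ => (savingN a u : ℝ) / u ^ 2) (fun k : ℕ => (measurableSet_Ioc : MeasurableSet
      (Set.Ioc ((k : ℝ) * T) ((k + 1) * T)))) (pairwise_disjoint_Ioc_mul hT)
    (by rw [iUnion_Ioc_mul hT]; exact integrableOn_savingN_div_sq ha)
  rwa [iUnion_Ioc_mul hT] at h

/-- Periodicity iterated: `N_a(u + nT) = N_a(u)`. -/
theorem savingN_add_nat_mul_period {a : Dir} (ha : BZBox a) {T : ℝ}
    (hper : ∀ k : Fin 28, ∃ z : ℤ, T * h28 a k = z) (u : ℝ) (n : ℕ) :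
    savingN a (u + n * T) = savingN a u := by
  induction n with
  | zero => simp
  | succ n ih => rw [Nat.cast_succ, add_mul, one_mul, ← add_assoc, savingN_add_period_of_BZBox ha hper, ih]

/-! ### The finite formula per period, and the exact formula for `Φ` -/

/-- **One gap**: if `N_a ≡ c` on `(α, β)` with `0 ≤ α ≤ β`, then `∫_α^β N_a u⁻² = c·(1/α − 1/β)` (for `α = 0` the
constant is forced to be `0`, `gapValue_zero_eq`, and both sides vanish — Lean's `1/0 = 0`). -/
theorem integral_gap {a : Dir} (ha : BZBox a) {α β : ℝ} (hα : 0 ≤ α) (hαβ : α ≤ β) {c : ℤ}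
    (hc : ∀ u ∈ Set.Ioo α β, savingN a u = c) :
    ∫ u in α..β, (savingN a u : ℝ) / u ^ 2 = c * (1 / α - 1 / β) := by
  rcases hα.eq_or_lt with h0 | hα'
  · subst h0
    rcases hαβ.eq_or_lt with h00 | hβ
    · subst h00; simp
    · have hc0 : c = 0 := gapValue_zero_eq ha hβ hc
      subst hc0
      rw [intervalIntegral.integral_of_le hαβ, integral_Ioc_eq_integral_Ioo,
        setIntegral_congr_fun measurableSet_Ioo (g := fun _ => (0 : ℝ)) (fun u hu => by
          simp only [hc u hu, Int.cast_zero, zero_div])]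
      simp
  · rw [intervalIntegral.integral_of_le hαβ, integral_Ioc_eq_integral_Ioo,
      setIntegral_congr_fun measurableSet_Ioo (g := fun u => (c : ℝ) / u ^ 2) (fun u hu => by
        simp only [hc u hu]),
      ← integral_Ioc_eq_integral_Ioo, ← intervalIntegral.integral_of_le hαβ]
    have hderiv : ∀ x ∈ uIcc α β, HasDerivAt (fun x : ℝ => -(c : ℝ) * x⁻¹) ((c : ℝ) / x ^ 2) x := by
      intro x hx
      rw [uIcc_of_le hαβ] at hx
      have hx0 : x ≠ 0 := (hα'.trans_le hx.1).ne'
      have h := (hasDerivAt_inv hx0).const_mul (-(c : ℝ))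
      refine h.congr_deriv ?_
      rw [neg_mul_neg, div_eq_mul_inv]
    have hint : IntervalIntegrable (fun x : ℝ => (c : ℝ) / x ^ 2) volume α β := by
      refine ContinuousOn.intervalIntegrable ?_
      refine continuousOn_of_forall_continuousAt fun x hx => ?_
      rw [uIcc_of_le hαβ] at hx
      have hx0 : x ≠ 0 := (hα'.trans_le hx.1).ne'
      exact continuousAt_const.div ((continuous_pow 2).continuousAt) (pow_ne_zero 2 hx0)
    rw [intervalIntegral.integral_eq_sub_of_hasDerivAt hderiv hint]
    have hβ0 : β ≠ 0 := (hα'.trans_le hαβ).ne'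
    field_simp
    ring

/-- Breakpoints are non-negative. -/
theorem breakpoints_nonneg {M : ℕ} {b : ℕ → ℝ} (hb0 : b 0 = 0) (hb : ∀ m < M, b m ≤ b (m + 1)) :
    ∀ m ≤ M, 0 ≤ b m := by
  intro m
  induction m with
  | zero => intro _; rw [hb0]
  | succ m ih => intro hm; exact (ih (Nat.le_of_succ_le hm)).trans (hb m (Nat.lt_of_succ_le hm))

/-- **One period as a finite sum**: with breakpoints `0 = b₀ ≤ ⋯ ≤ b_M = T` of ONE period and gap values `c_m`
(`N_a ≡ c_m` on `(b_m, b_{m+1})`), the `k`-th period contributes `Σ_{m<M} c_m (1/(kT+b_m) − 1/(kT+b_{m+1}))`. -/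
theorem integral_period_eq_sum {a : Dir} (ha : BZBox a) {T : ℝ} (hT : 0 < T)
    (hper : ∀ k : Fin 28, ∃ z : ℤ, T * h28 a k = z) {M : ℕ} {b : ℕ → ℝ} (hb0 : b 0 = 0) (hbM : b M = T)
    (hb : ∀ m < M, b m ≤ b (m + 1)) {c : ℕ → ℤ}
    (hc : ∀ m < M, ∀ u ∈ Set.Ioo (b m) (b (m + 1)), savingN a u = c m) (k : ℕ) :
    ∫ u in Set.Ioc ((k : ℝ) * T) ((k + 1) * T), (savingN a u : ℝ) / u ^ 2 =
      ∑ m ∈ Finset.range M, (c m : ℝ) * (1 / (k * T + b m) - 1 / (k * T + b (m + 1))) := by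
  have hbnn := breakpoints_nonneg hb0 hb
  have hkT : (k : ℝ) * T ≤ (k + 1) * T := by nlinarith
  have hk0 : (0 : ℝ) ≤ k * T := by positivity
  rw [← intervalIntegral.integral_of_le hkT]
  have hint : ∀ m < M, IntervalIntegrable (fun u : ℝ => (savingN a u : ℝ) / u ^ 2) volume
      ((k : ℝ) * T + b m) ((k : ℝ) * T + b (m + 1)) := by
    intro m hm
    have hle : (k : ℝ) * T + b m ≤ (k : ℝ) * T + b (m + 1) := by linarith [hb m hm]
    rw [intervalIntegrable_iff_integrableOn_Ioc_of_le hle]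
    exact (integrableOn_savingN_div_sq ha).mono_set
      (Ioc_subset_Ioi_self.trans (Ioi_subset_Ioi (add_nonneg hk0 (hbnn m hm.le))))
  have hsum := intervalIntegral.sum_integral_adjacent_intervals hint
  rw [hb0, add_zero, hbM, show (k : ℝ) * T + T = (k + 1) * T by ring] at hsum
  rw [← hsum]
  refine Finset.sum_congr rfl fun m hm => ?_
  rw [Finset.mem_range] at hm
  have hα : 0 ≤ (k : ℝ) * T + b m := add_nonneg hk0 (hbnn m hm.le)
  have hαβ : (k : ℝ) * T + b m ≤ k * T + b (m + 1) := by linarith [hb m hm]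
  rw [integral_gap ha hα hαβ (c := c m) (fun u hu => ?_)]
  have h := hc m hm (u - k * T) ⟨by linarith [hu.1], by linarith [hu.2]⟩
  rwa [show u - (k : ℝ) * T = u + (-(k : ℝ) * T) by ring, ← savingN_add_nat_mul_period ha hper (u + -(k : ℝ) * T) k,
    show u + -(k : ℝ) * T + k * T = u by ring] at h

/-- **EXACT PERIOD FORMULA (P3), series form**: `Φ(a) = Σ_{k≥0} Σ_{m<M} c_m (1/(kT+b_m) − 1/(kT+b_{m+1}))`. -/
theorem hasSum_phi30_breakpoints {a : Dir} (ha : BZBox a) {T : ℝ} (hT : 0 < T)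
    (hper : ∀ k : Fin 28, ∃ z : ℤ, T * h28 a k = z) {M : ℕ} {b : ℕ → ℝ} (hb0 : b 0 = 0) (hbM : b M = T)
    (hb : ∀ m < M, b m ≤ b (m + 1)) {c : ℕ → ℤ}
    (hc : ∀ m < M, ∀ u ∈ Set.Ioo (b m) (b (m + 1)), savingN a u = c m) :
    HasSum (fun k : ℕ => ∑ m ∈ Finset.range M, (c m : ℝ) * (1 / (k * T + b m) - 1 / (k * T + b (m + 1))))
      (phi30 a) := by
  have h := hasSum_integral_periods ha hT
  have hfun : (fun k : ℕ => ∫ u in Set.Ioc ((k : ℝ) * T) ((k + 1) * T), (savingN a u : ℝ) / u ^ 2) =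
      fun k : ℕ => ∑ m ∈ Finset.range M, (c m : ℝ) * (1 / (k * T + b m) - 1 / (k * T + b (m + 1))) :=
    funext fun k => integral_period_eq_sum ha hT hper hb0 hbM hb hc k
  rwa [hfun] at h

/-- The gap series `Σ_k (1/(kT+x) − 1/(kT+y))` is summable (`O(k⁻²)` terms). -/
theorem summable_gapSeries {T x y : ℝ} (hT : 0 < T) (hx : 0 ≤ x) (hxy : x ≤ y) :
    Summable fun k : ℕ => 1 / (k * T + x) - 1 / (k * T + y) := by
  rw [← summable_nat_add_iff 1]
  have hs : Summable fun k : ℕ => (y - x) / T ^ 2 * (1 / ((k : ℝ) + 1) ^ 2) := by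
    have h := Real.summable_one_div_nat_pow.2 one_lt_two
    have h' : Summable fun k : ℕ => 1 / ((k : ℝ) + 1) ^ 2 := by
      exact_mod_cast (summable_nat_add_iff 1).2 h
    exact h'.mul_left _
  refine Summable.of_norm_bounded hs fun k => ?_
  have hK : 0 < ((k : ℝ) + 1) * T := by positivity
  have hKx : 0 < ((k : ℝ) + 1) * T + x := add_pos_of_pos_of_nonneg hK hx
  have hKy : 0 < ((k : ℝ) + 1) * T + y := add_pos_of_pos_of_nonneg hK (hx.trans hxy)
  rw [Real.norm_eq_abs]
  have hcast : (((k + 1 : ℕ)) : ℝ) * T = ((k : ℝ) + 1) * T := by push_cast; ring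
  have hid : 1 / ((((k + 1 : ℕ)) : ℝ) * T + x) - 1 / ((((k + 1 : ℕ)) : ℝ) * T + y) =
      (y - x) / ((((k : ℝ) + 1) * T + x) * (((k : ℝ) + 1) * T + y)) := by
    rw [hcast, div_sub_div _ _ hKx.ne' hKy.ne']
    congr 1
    ring
  rw [hid, abs_of_nonneg (div_nonneg (by linarith) (mul_pos hKx hKy).le)]
  calc (y - x) / ((((k : ℝ) + 1) * T + x) * (((k : ℝ) + 1) * T + y))
      ≤ (y - x) / ((((k : ℝ) + 1) * T) * (((k : ℝ) + 1) * T)) :=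
        div_le_div_of_nonneg_left (by linarith) (mul_pos hK hK) (by nlinarith)
    _ = (y - x) / T ^ 2 * (1 / ((k : ℝ) + 1) ^ 2) := by field_simp

/-- **EXACT PERIOD FORMULA (P3), finite form**:
`Φ(a) = Σ_{m<M} c_m · Σ_{k≥0} (1/(kT+b_m) − 1/(kT+b_{m+1}))` — a finite combination of convergent elementary
series determined by the breakpoints and values of ONE period of the saving. -/
theorem phi30_eq_sum_tsum {a : Dir} (ha : BZBox a) {T : ℝ} (hT : 0 < T)
    (hper : ∀ k : Fin 28, ∃ z : ℤ, T * h28 a k = z) {M : ℕ} {b : ℕ → ℝ} (hb0 : b 0 = 0) (hbM : b M = T)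
    (hb : ∀ m < M, b m ≤ b (m + 1)) {c : ℕ → ℤ}
    (hc : ∀ m < M, ∀ u ∈ Set.Ioo (b m) (b (m + 1)), savingN a u = c m) :
    phi30 a = ∑ m ∈ Finset.range M, (c m : ℝ) * ∑' k : ℕ, (1 / (k * T + b m) - 1 / (k * T + b (m + 1))) := by
  have hmain := hasSum_phi30_breakpoints ha hT hper hb0 hbM hb hc
  have hbnn := breakpoints_nonneg hb0 hb
  have h2 : HasSum (fun k : ℕ => ∑ m ∈ Finset.range M,
      (c m : ℝ) * (1 / (k * T + b m) - 1 / (k * T + b (m + 1))))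
      (∑ m ∈ Finset.range M, (c m : ℝ) * ∑' k : ℕ, (1 / (k * T + b m) - 1 / (k * T + b (m + 1)))) := by
    refine hasSum_sum fun m hm => ?_
    rw [Finset.mem_range] at hm
    exact (summable_gapSeries hT (hbnn m hm.le) (hb m hm)).hasSum.mul_left _
  exact hmain.unique h2

end Summit.KontsevichZagierPeriods.Zeta5Search.Barrier.ConeGamma

end
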